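import Summits.FinalStateConjecture.FinalStateConjecture.Theses.SwallowTheDatum
import Literature.Geometry.Lorentzian.CauchyProblemCauchy
import Literature.Geometry.Lorentzian.CauchyProblemMGHDExistence
import Literature.Geometry.Lorentzian.DataEmbeddingConstraints
import Literature.Geometry.Lorentzian.DataEmbeddingNormalSmooth
import Literature.Geometry.Lorentzian.LeviCivitaProofs

/-!
# Route SwallowTheDatum · item `SubdataDevelopmentsEmbed` (stmt-FinalStateConjecture-10053) —
# the order-theoretic frame: reduction to the relative extension property

The route decl
`Summit.FinalStateConjecture.FinalStateConjecture.Theses.SwallowTheDatum.SubdataDevelopmentsEmbed`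
reads: if `𝒟` is a MAXIMAL vacuum Cauchy development of the data `D` on `X` and `Φ : N → X` is a
smooth open embedding with injective differentials (`N` connected), then every vacuum Cauchy
development `𝒟'` of the pulled-back data `D.comap Φ` embeds into `𝒟` over `Φ` (a smooth,
time-orientation preserving, isometric open embedding `χ` with `χ ∘ ι' = ι ∘ Φ`). This is the
sub-data ("domain of dependence") half of Choquet-Bruhat–Geroch's theorem (Comm. Math. Phys. 14
(1969), Thm. 3; Hawking–Ellis 1973, §7.6; Sbierski, Ann. Henri Poincaré 17 (2016), Thm. 2.7–2.8 —
all printed for developments of the SAME data; the relative form is proved by the same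
gluing-along-the-maximal-common-development and Hausdorff argument, Sbierski 2016, §3.2–3.3).

This file isolates the part of the statement that is pure order theory over the prelude
(`CauchyDevelopment.EmbedsInto` is a preorder: `EmbedsInto.refl`, `EmbedsInto.trans`;
maximality = every development embeds). Write `RelExt` for the **relative extension property**:
for every data set `D` on `X` admitting some vacuum Cauchy development, every `Φ` as above and
every vacuum Cauchy development `𝒟'` of `D.comap Φ`, there is SOME vacuum Cauchy development `𝒟₃`
of `D` into which `𝒟'` embeds over `Φ`. Then

* `subdataDevelopmentsEmbed_of_relative_extension` : `RelExt → SubdataDevelopmentsEmbed`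
  (maximality of `𝒟` absorbs `𝒟₃`, and embeddings compose — `IsIsometricImmersion.comp`,
  `PreservesTimeOrientation.comp`, the timecone lemma);
* `relative_extension_of_subdataDevelopmentsEmbed` : conversely `SubdataDevelopmentsEmbed → RelExt`
  given that every data set admitting a vacuum Cauchy development admits a maximal one (the
  existence half of Choquet-Bruhat–Geroch, Thm. 3, in the form the converse needs; hypothesis
  `hmax`, not a named fact here);
* `subdataDevelopmentsEmbed_iff_relative_extension` : the equivalence under `hmax`.

So, over the prelude plus MGHD existence, the item is EQUIVALENT to `RelExt` — the relative form
of Sbierski's common-extension theorem (2016, Thm. 2.7) with the first development forgotten —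
which is exactly what the gluing construction (maximal common globally hyperbolic development of
`𝒟'` and the domain of dependence of `ι(Φ N)` in a development of `D`; absence of corresponding
boundary points by local geometric uniqueness; Hausdorff quotient; Cauchy property of `ι(X)` in
the glued spacetime) has to deliver. No definition is introduced; nothing is restated as a fact.
-/

noncomputable section

open scoped Manifold ContDiff
open Function Topology

namespace Summit.FinalStateConjecture.FinalStateConjecture.Theorems

open Literature.Geometry.Lorentzian

/-- **Item `SubdataDevelopmentsEmbed` from the relative extension property.** If every vacuum
Cauchy development `𝒟'` of sub-data `D.comap Φ` (along a smooth open embedding `Φ : N → X` with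
injective differentials, `N` connected) of a data set `D` that admits a vacuum Cauchy development
embeds over `Φ` into SOME vacuum Cauchy development `𝒟₃` of `D`, then it embeds into every MAXIMAL
one: `𝒟₃` embeds into the maximal `𝒟` by an embedding `ψ` with `ψ ∘ ι₃ = ι`
(`VacuumCauchyDevelopment.IsMaximal`), and `ψ ∘ χ` is again a smooth, time-orientation
preserving, isometric open embedding (`IsIsometricImmersion.comp`, `IsOpenEmbedding.comp`,
`PreservesTimeOrientation.comp`) with `(ψ ∘ χ) ∘ ι' = ψ ∘ ι₃ ∘ Φ = ι ∘ Φ`. Choquet-Bruhat–Geroch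
1969, Thm. 3 (maximality), with Ringström 2009, Def. 16.5 (embeddings compose). -/
theorem subdataDevelopmentsEmbed_of_relative_extension
    (hrel : ∀ (X : Type) [TopologicalSpace X] [ChartedSpace E3 X] [IsManifold (𝓡 3) ∞ X]
      [T2Space X] [SecondCountableTopology X] [ConnectedSpace X] (D : InitialDataSet (𝓡 3) X),
      Nonempty (VacuumCauchyDevelopment D) →
      ∀ (N : Type) [TopologicalSpace N] [ChartedSpace E3 N] [IsManifold (𝓡 3) ∞ N]
      [ConnectedSpace N] (Φ : N → X) (hΦ : ContMDiff (𝓡 3) (𝓡 3) (∞ + 1) Φ)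
      (hΦ' : ∀ u, Injective (mfderiv (𝓡 3) (𝓡 3) Φ u)), IsOpenEmbedding Φ →
      ∀ 𝒟' : VacuumCauchyDevelopment (D.comap Φ hΦ hΦ'),
      ∃ (𝒟₃ : VacuumCauchyDevelopment D) (χ : 𝒟'.carrier → 𝒟₃.carrier),
        ContMDiff (𝓡 4) (𝓡 4) ∞ χ ∧ IsOpenEmbedding χ ∧
          𝒟'.metric.IsIsometricImmersion 𝒟₃.metric.toPseudoRiemannianMetric χ ∧
          𝒟'.timeOrientation.PreservesTimeOrientation χ 𝒟₃.timeOrientation ∧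
          χ ∘ 𝒟'.embed = 𝒟₃.embed ∘ Φ) :
    Summit.FinalStateConjecture.FinalStateConjecture.Theses.SwallowTheDatum.SubdataDevelopmentsEmbed := by
  unfold Theses.SwallowTheDatum.SubdataDevelopmentsEmbed
  intro X _ _ _ _ _ _ D 𝒟 hmax N _ _ _ _ Φ hΦ hΦ' hΦo 𝒟'
  obtain ⟨𝒟₃, χ, hχs, hχo, hχi, hχt, hχc⟩ := hrel X D ⟨𝒟⟩ N Φ hΦ hΦ' hΦo 𝒟'
  obtain ⟨ψ, hψs, hψo, hψi, hψt, hψc⟩ := hmax 𝒟₃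
  refine ⟨ψ ∘ χ, hψs.comp hχs, hψo.comp hχo, hψi.comp hχi,
    hψt.comp hχt hψi.2 (hψs.mdifferentiable (by simp)) (hχs.mdifferentiable (by simp)), ?_⟩
  rw [comp_assoc, hχc, ← comp_assoc, hψc]

/-- **The relative extension property from item `SubdataDevelopmentsEmbed`, given MGHD
existence.** If every data set admitting a vacuum Cauchy development admits a maximal one
(hypothesis `hmax`: the existence half of Choquet-Bruhat–Geroch 1969, Thm. 3 / Sbierski 2016,
Thm. 2.8, for developable data) and `SubdataDevelopmentsEmbed` holds, then every vacuum Cauchy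
development of sub-data `D.comap Φ` embeds over `Φ` into some vacuum Cauchy development of `D` —
namely into a maximal one. (The trivial direction; cf. Sbierski 2016, §2: "Theorem 2.8 clearly
implies Theorem 2.7".) -/
theorem relative_extension_of_subdataDevelopmentsEmbed
    (hmax : ∀ (X : Type) [TopologicalSpace X] [ChartedSpace E3 X] [IsManifold (𝓡 3) ∞ X]
      [T2Space X] [SecondCountableTopology X] [ConnectedSpace X] (D : InitialDataSet (𝓡 3) X),
      Nonempty (VacuumCauchyDevelopment D) → ∃ 𝒟 : VacuumCauchyDevelopment D, 𝒟.IsMaximal)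
    (hS : Summit.FinalStateConjecture.FinalStateConjecture.Theses.SwallowTheDatum.SubdataDevelopmentsEmbed)
    (X : Type) [TopologicalSpace X] [ChartedSpace E3 X] [IsManifold (𝓡 3) ∞ X]
    [T2Space X] [SecondCountableTopology X] [ConnectedSpace X] (D : InitialDataSet (𝓡 3) X)
    (hD : Nonempty (VacuumCauchyDevelopment D))
    (N : Type) [TopologicalSpace N] [ChartedSpace E3 N] [IsManifold (𝓡 3) ∞ N]
    [ConnectedSpace N] (Φ : N → X) (hΦ : ContMDiff (𝓡 3) (𝓡 3) (∞ + 1) Φ)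
    (hΦ' : ∀ u, Injective (mfderiv (𝓡 3) (𝓡 3) Φ u)) (hΦo : IsOpenEmbedding Φ)
    (𝒟' : VacuumCauchyDevelopment (D.comap Φ hΦ hΦ')) :
    ∃ (𝒟₃ : VacuumCauchyDevelopment D) (χ : 𝒟'.carrier → 𝒟₃.carrier),
      ContMDiff (𝓡 4) (𝓡 4) ∞ χ ∧ IsOpenEmbedding χ ∧
        𝒟'.metric.IsIsometricImmersion 𝒟₃.metric.toPseudoRiemannianMetric χ ∧
        𝒟'.timeOrientation.PreservesTimeOrientation χ 𝒟₃.timeOrientation ∧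
        χ ∘ 𝒟'.embed = 𝒟₃.embed ∘ Φ := by
  obtain ⟨𝒟, h𝒟⟩ := hmax X D hD
  exact ⟨𝒟, hS X D 𝒟 h𝒟 N Φ hΦ hΦ' hΦo 𝒟'⟩

/-- **Over MGHD existence (for developable data), item `SubdataDevelopmentsEmbed` is EQUIVALENT to
the relative extension property** — the relative form of Sbierski's common-extension theorem
(2016, Thm. 2.7) with the first development forgotten: every vacuum Cauchy development of
sub-data of a developable data set embeds, over the sub-datum, into some vacuum Cauchy
development of the full data. This displays what an unconditional proof of the item owes beyond
MGHD existence: the relative gluing construction (Choquet-Bruhat–Geroch 1969, pp. 333–334;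
Sbierski 2016, §3). -/
theorem subdataDevelopmentsEmbed_iff_relative_extension
    (hmax : ∀ (X : Type) [TopologicalSpace X] [ChartedSpace E3 X] [IsManifold (𝓡 3) ∞ X]
      [T2Space X] [SecondCountableTopology X] [ConnectedSpace X] (D : InitialDataSet (𝓡 3) X),
      Nonempty (VacuumCauchyDevelopment D) → ∃ 𝒟 : VacuumCauchyDevelopment D, 𝒟.IsMaximal) :
    Summit.FinalStateConjecture.FinalStateConjecture.Theses.SwallowTheDatum.SubdataDevelopmentsEmbed ↔
      ∀ (X : Type) [TopologicalSpace X] [ChartedSpace E3 X] [IsManifold (𝓡 3) ∞ X]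
        [T2Space X] [SecondCountableTopology X] [ConnectedSpace X] (D : InitialDataSet (𝓡 3) X),
        Nonempty (VacuumCauchyDevelopment D) →
        ∀ (N : Type) [TopologicalSpace N] [ChartedSpace E3 N] [IsManifold (𝓡 3) ∞ N]
        [ConnectedSpace N] (Φ : N → X) (hΦ : ContMDiff (𝓡 3) (𝓡 3) (∞ + 1) Φ)
        (hΦ' : ∀ u, Injective (mfderiv (𝓡 3) (𝓡 3) Φ u)), IsOpenEmbedding Φ →
        ∀ 𝒟' : VacuumCauchyDevelopment (D.comap Φ hΦ hΦ'),
        ∃ (𝒟₃ : VacuumCauchyDevelopment D) (χ : 𝒟'.carrier → 𝒟₃.carrier),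
          ContMDiff (𝓡 4) (𝓡 4) ∞ χ ∧ IsOpenEmbedding χ ∧
            𝒟'.metric.IsIsometricImmersion 𝒟₃.metric.toPseudoRiemannianMetric χ ∧
            𝒟'.timeOrientation.PreservesTimeOrientation χ 𝒟₃.timeOrientation ∧
            χ ∘ 𝒟'.embed = 𝒟₃.embed ∘ Φ :=
  ⟨fun hS X _ _ _ _ _ _ D hD N _ _ _ _ Φ hΦ hΦ' hΦo 𝒟' ↦
      relative_extension_of_subdataDevelopmentsEmbed hmax hS X D hD N Φ hΦ hΦ' hΦo 𝒟',
    subdataDevelopmentsEmbed_of_relative_extension⟩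

/-! ### The same over the named fact `choquetBruhat_geroch_exists_mghd_cauchy` -/

/-- **MGHD existence for developable data, from the named fact.** Under
`choquetBruhat_geroch_exists_mghd_cauchy` (Choquet-Bruhat–Geroch 1969, Thm. 3, stated for smooth
solutions of the vacuum constraints) every data set admitting SOME vacuum Cauchy development
admits a maximal one: the data of a vacuum Cauchy development solve the constraints (Gauss and
Codazzi, `InitialDataSet.isVacuumConstraintSolution_of_dataEmbedding`, with the smoothness of the
normal `DataEmbedding.contMDiffAt_embed_normal`; the Levi-Civita hypothesis is the canonical
instance `PseudoRiemannianMetric.hasLeviCivita`). This is the hypothesis `hmax` of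
`relative_extension_of_subdataDevelopmentsEmbed` discharged from the fact. -/
theorem exists_isMaximal_of_nonempty_of_choquetBruhatGeroch
    (h : choquetBruhat_geroch_exists_mghd_cauchy) (X : Type) [TopologicalSpace X]
    [ChartedSpace E3 X] [IsManifold (𝓡 3) ∞ X] [T2Space X] [SecondCountableTopology X]
    [ConnectedSpace X] (D : InitialDataSet (𝓡 3) X) (hD : Nonempty (VacuumCauchyDevelopment D)) :
    ∃ 𝒟 : VacuumCauchyDevelopment D, 𝒟.IsMaximal := by
  obtain ⟨𝒟₀⟩ := hD
  haveI := D.metric.hasLeviCivita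
  exact h X D (InitialDataSet.isVacuumConstraintSolution_of_dataEmbedding 𝒟₀.toDataEmbedding
    𝒟₀.isVacuum fun x ↦ 𝒟₀.contMDiffAt_embed_normal x)

/-- **Over the named fact `choquetBruhat_geroch_exists_mghd_cauchy`, item `SubdataDevelopmentsEmbed`
is EQUIVALENT to the relative extension property** (`subdataDevelopmentsEmbed_iff_relative_extension`
with its MGHD-existence hypothesis discharged by
`exists_isMaximal_of_nonempty_of_choquetBruhatGeroch`). -/
theorem subdataDevelopmentsEmbed_iff_relative_extension_of_choquetBruhatGeroch
    (h : choquetBruhat_geroch_exists_mghd_cauchy) :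
    Summit.FinalStateConjecture.FinalStateConjecture.Theses.SwallowTheDatum.SubdataDevelopmentsEmbed ↔
      ∀ (X : Type) [TopologicalSpace X] [ChartedSpace E3 X] [IsManifold (𝓡 3) ∞ X]
        [T2Space X] [SecondCountableTopology X] [ConnectedSpace X] (D : InitialDataSet (𝓡 3) X),
        Nonempty (VacuumCauchyDevelopment D) →
        ∀ (N : Type) [TopologicalSpace N] [ChartedSpace E3 N] [IsManifold (𝓡 3) ∞ N]
        [ConnectedSpace N] (Φ : N → X) (hΦ : ContMDiff (𝓡 3) (𝓡 3) (∞ + 1) Φ)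
        (hΦ' : ∀ u, Injective (mfderiv (𝓡 3) (𝓡 3) Φ u)), IsOpenEmbedding Φ →
        ∀ 𝒟' : VacuumCauchyDevelopment (D.comap Φ hΦ hΦ'),
        ∃ (𝒟₃ : VacuumCauchyDevelopment D) (χ : 𝒟'.carrier → 𝒟₃.carrier),
          ContMDiff (𝓡 4) (𝓡 4) ∞ χ ∧ IsOpenEmbedding χ ∧
            𝒟'.metric.IsIsometricImmersion 𝒟₃.metric.toPseudoRiemannianMetric χ ∧
            𝒟'.timeOrientation.PreservesTimeOrientation χ 𝒟₃.timeOrientation ∧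
            χ ∘ 𝒟'.embed = 𝒟₃.embed ∘ Φ :=
  subdataDevelopmentsEmbed_iff_relative_extension
    (exists_isMaximal_of_nonempty_of_choquetBruhatGeroch h)

end Summit.FinalStateConjecture.FinalStateConjecture.Theorems

end
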